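import Mathlib
import Summits.Ventures.PercRepro2.CrossAPrimeFreeEdge
import Summits.Ventures.PercRepro2.CrossAPrimeIsolatedFlip
/-!
# The three-route blob class, I: the eight pinned measures of the gadget
(blind cell PercRepro2, p5 g36; S4 §2.4 (s) addendum 38 (4); continued in `CrossAPrimeThreeRoutesBlob`)

The gadget is a vertex `z` whose only edges are `e₁ = {a₁, z}`, `e₂ = {z, v}` and the coin
`e₃ = {a₂, z}`.  The six mass events of `crossC` are flip-invariant at `z` (`flipInv_masses`), so
the pinned measures `(1,0,0)`, `(0,1,0)`, `(0,0,1)` have the masses of `(0,0,0)` (`prob_flip₁`,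
`prob_flip₂`, `prob_flip₃`, by `CrossAPrimeIsolatedFlip`); with `e₁, e₃` sure, `Q = ∅`
(`prob_eq_zero_of_sure_path`); with `e₂, e₃` sure, `v ∈ K` and the route masses vanish
(`prob_QL_eq_zero_of_sure_vpath`); with `e₁, e₂` sure, the masses are the `v ∉ K` masses of
`(0,0,0)` (`prob_sure_path_eq`: the events `{a₂ ↮ a₁, z, v} ∩ ·` are determined off `e₁, e₂`,
and `z ∉ K` on the support of `(0,0,0)`).  The constant `π̃₁₂ + aζ(1 − π̃₁₂)` is admissible
(`const_le_pi_blob`).  Own work; standard axioms.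
-/

namespace Summit.Ventures.PercRepro2

open LeafRowPendantRootSO CrossAPrimeA2Route CrossAPrimeSupport CrossAPrimeTwoRoutes
  CrossAPrimeTwoRoutesSupp CrossAPrimeAvoidCrux CrossAPrimeFreeEdge CrossAPrimeIsolatedFlip

namespace CrossAPrimeThreeRoutesBlobMasses

section Events

variable {V : Type*} {E : Type*} [DecidableEq E] {ends : E → Sym2 V}

/-- The six mass events are flip-invariant at a vertex `z` off the marks. -/
lemma flipInv_masses {o a₁ a₂ v b z : V} (hza₁ : a₁ ≠ z) (hza₂ : a₂ ≠ z) (hzo : o ≠ z)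
    (hzb : b ≠ z) (hzv : v ≠ z) :
    (∀ (e : E) (t : V), ends e = s(t, z) → ∀ ω : Config E,
        (∀ e', z ∈ ends e' → ω e' = false) → (Function.update ω e true ∈ avoidAll ends a₂ {a₁} ↔ ω ∈ avoidAll ends a₂ {a₁})) ∧
      (∀ (e : E) (t : V), ends e = s(t, z) → ∀ ω : Config E,
        (∀ e', z ∈ ends e' → ω e' = false) → (Function.update ω e true ∈ avoidAll ends a₂ {a₁} ∩ connEvent ends a₂ o ↔ ω ∈ avoidAll ends a₂ {a₁} ∩ connEvent ends a₂ o)) ∧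
      (∀ (e : E) (t : V), ends e = s(t, z) → ∀ ω : Config E,
        (∀ e', z ∈ ends e' → ω e' = false) → (Function.update ω e true ∈ avoidAll ends a₂ {a₁} ∩ connEvent ends a₂ b ↔ ω ∈ avoidAll ends a₂ {a₁} ∩ connEvent ends a₂ b)) ∧
      (∀ (e : E) (t : V), ends e = s(t, z) → ∀ ω : Config E,
        (∀ e', z ∈ ends e' → ω e' = false) → (Function.update ω e true ∈ avoidAll ends a₂ {a₁} ∩ (connEvent ends a₁ v ∩ connEvent ends a₂ o) ↔ ω ∈ avoidAll ends a₂ {a₁} ∩ (connEvent ends a₁ v ∩ connEvent ends a₂ o))) ∧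
      (∀ (e : E) (t : V), ends e = s(t, z) → ∀ ω : Config E,
        (∀ e', z ∈ ends e' → ω e' = false) → (Function.update ω e true ∈ avoidAll ends a₂ {a₁} ∩ (connEvent ends a₁ v ∩ connEvent ends a₂ b) ↔ ω ∈ avoidAll ends a₂ {a₁} ∩ (connEvent ends a₁ v ∩ connEvent ends a₂ b))) ∧
      (∀ (e : E) (t : V), ends e = s(t, z) → ∀ ω : Config E,
        (∀ e', z ∈ ends e' → ω e' = false) → (Function.update ω e true ∈ avoidAll ends a₂ {a₁} ∩ (connEvent ends a₁ v ∩ (connEvent ends a₂ o ∩ connEvent ends a₂ b)) ↔ ω ∈ avoidAll ends a₂ {a₁} ∩ (connEvent ends a₁ v ∩ (connEvent ends a₂ o ∩ connEvent ends a₂ b)))) := by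
  classical
  refine ⟨?_, ?_, ?_, ?_, ?_, ?_⟩ <;> intro e t hends ω hiso <;>
    obtain ⟨hQ, hoK, hbK, hL, -⟩ := flip_iff_of_isolated hends hiso hza₁ hza₂ hzo hzb hzv <;>
    simp only [Set.mem_inter_iff, hQ, hoK, hbK, hL]

end Events
section Identify

variable {V : Type*} {E : Type*} [Fintype E] [DecidableEq E] [DecidableEq V] {R : Type*} [Field R]
  [LinearOrder R] [IsStrictOrderedRing R]
variable {ends : E → Sym2 V}

omit [DecidableEq V] [LinearOrder R] [IsStrictOrderedRing R] in
/-- On a measure with `e₁ = {a₁, z}` and `e₃ = {a₂, z}` sure, every sub-event of `Q` is null. -/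
lemma prob_eq_zero_of_sure_path (q : E → R) {e₁ e₃ : E} {a₁ a₂ z : V} (h₁ : ends e₁ = s(a₁, z))
    (h₃ : ends e₃ = s(a₂, z)) (hq₁ : q e₁ = 1) (hq₃ : q e₃ = 1) {X : Set (Config E)}
    (hX : X ⊆ avoidAll ends a₂ {a₁}) : prob q X = 0 := by
  rw [← prob_empty q]
  apply prob_congr_supp
  ext ω
  simp only [Set.mem_inter_iff, Set.mem_empty_iff_false, false_and, iff_false, not_and]
  intro hω hs
  have ho₁ : ω e₁ = true := (hs e₁).1 hq₁
  have ho₃ : ω e₃ = true := (hs e₃).1 hq₃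
  have hc : Conn ends ω a₂ a₁ :=
    conn_trans (conn_of_openAdj ⟨e₃, ho₃, h₃⟩) (conn_symm (conn_of_openAdj ⟨e₁, ho₁, h₁⟩))
  exact hX hω a₁ (Finset.mem_singleton_self a₁) hc

omit [DecidableEq V] [LinearOrder R] [IsStrictOrderedRing R] in
/-- On a measure with `e₂ = {z, v}` and `e₃ = {a₂, z}` sure, `v ∈ K` and the route masses vanish. -/
lemma prob_QL_eq_zero_of_sure_vpath (q : E → R) {e₂ e₃ : E} {a₁ a₂ z v : V}
    (h₂ : ends e₂ = s(z, v)) (h₃ : ends e₃ = s(a₂, z)) (hq₂ : q e₂ = 1) (hq₃ : q e₃ = 1)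
    (A : Set (Config E)) :
    prob q (avoidAll ends a₂ {a₁} ∩ (connEvent ends a₁ v ∩ A)) = 0 := by
  rw [← prob_empty q]
  apply prob_congr_supp
  ext ω
  simp only [Set.mem_inter_iff, Set.mem_empty_iff_false, false_and, iff_false, not_and]
  rintro ⟨hQ, hL, -⟩ hs
  have ho₂ : ω e₂ = true := (hs e₂).1 hq₂
  have ho₃ : ω e₃ = true := (hs e₃).1 hq₃
  have hc : Conn ends ω a₂ a₁ :=
    conn_trans (conn_trans (conn_of_openAdj ⟨e₃, ho₃, h₃⟩) (conn_of_openAdj ⟨e₂, ho₂, h₂⟩))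
      (conn_symm hL)
  exact hQ a₁ (Finset.mem_singleton_self a₁) hc

omit [Fintype E] [DecidableEq V] [Field R] [LinearOrder R] [IsStrictOrderedRing R] in
/-- `Function.update_comm` for weight vectors. -/
lemma update_comm' (f : E → R) {a b : E} (h : a ≠ b) (v w : R) :
    Function.update (Function.update f a v) b w = Function.update (Function.update f b w) a v :=
  Function.update_comm h v w f

omit [Fintype E] [DecidableEq V] [LinearOrder R] [IsStrictOrderedRing R] in
/-- Products over a route avoid the three gadget edges. -/
lemma prod_update_three (p : E → R) {e₁ e₂ e₃ : E} (ε₁ ε₂ ε₃ : R) {π : Finset E}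
    (h₁ : e₁ ∉ π) (h₂ : e₂ ∉ π) (h₃ : e₃ ∉ π) :
    ∏ e ∈ π, Function.update (Function.update (Function.update p e₁ ε₁) e₂ ε₂) e₃ ε₃ e =
      ∏ e ∈ π, p e := by
  refine Finset.prod_congr rfl fun e he => ?_
  rw [Function.update_of_ne (ne_of_mem_of_not_mem he h₃),
    Function.update_of_ne (ne_of_mem_of_not_mem he h₂),
    Function.update_of_ne (ne_of_mem_of_not_mem he h₁)]

omit [DecidableEq V] [LinearOrder R] [IsStrictOrderedRing R] in
/-- Flip `e₃` (the coin) at the isolated `z`: `(0,0,1) → (0,0,0)`. -/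
lemma prob_flip₃ (p : E → R) {e₁ e₂ e₃ : E} {a₂ z : V} (h₃ : ends e₃ = s(a₂, z))
    (hz : ∀ e, z ∈ ends e → e = e₁ ∨ e = e₂ ∨ e = e₃) (h₁₂ : e₁ ≠ e₂) (h₂₃ : e₂ ≠ e₃)
    {X : Set (Config E)} (hX : ∀ (e : E) (t : V), ends e = s(t, z) → ∀ ω : Config E,
      (∀ e', z ∈ ends e' → ω e' = false) → (Function.update ω e true ∈ X ↔ ω ∈ X)) :
    prob (Function.update (Function.update (Function.update p e₁ 0) e₂ 0) e₃ 1) X =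
      prob (Function.update (Function.update (Function.update p e₁ 0) e₂ 0) e₃ 0) X := by
  refine prob_update_one_eq_update_zero_of_isolated (ends := ends) _ (z := z) ?_ (hX e₃ a₂ h₃)
  intro e' hz' hne
  rcases hz e' hz' with rfl | rfl | rfl
  · rw [Function.update_of_ne h₁₂]; simp
  · simp
  · exact absurd rfl hne

omit [DecidableEq V] [LinearOrder R] [IsStrictOrderedRing R] in
/-- Flip `e₂` at the isolated `z`: `(0,1,0) → (0,0,0)`. -/
lemma prob_flip₂ (p : E → R) {e₁ e₂ e₃ : E} {z v : V} (h₂ : ends e₂ = s(z, v))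
    (hz : ∀ e, z ∈ ends e → e = e₁ ∨ e = e₂ ∨ e = e₃) (h₁₂ : e₁ ≠ e₂) (h₁₃ : e₁ ≠ e₃)
    (h₂₃ : e₂ ≠ e₃) {X : Set (Config E)} (hX : ∀ (e : E) (t : V), ends e = s(t, z) → ∀ ω : Config E,
      (∀ e', z ∈ ends e' → ω e' = false) → (Function.update ω e true ∈ X ↔ ω ∈ X)) :
    prob (Function.update (Function.update (Function.update p e₁ 0) e₂ 1) e₃ 0) X =
      prob (Function.update (Function.update (Function.update p e₁ 0) e₂ 0) e₃ 0) X := by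
  rw [update_comm' (Function.update p e₁ 0) h₂₃ 1 0, update_comm' (Function.update p e₁ 0) h₂₃ 0 0]
  have h₂' : ends e₂ = s(v, z) := by rw [h₂, Sym2.eq_swap]
  refine prob_update_one_eq_update_zero_of_isolated (ends := ends) _ (z := z) ?_ (hX e₂ v h₂')
  intro e' hz' hne
  rcases hz e' hz' with rfl | rfl | rfl
  · rw [Function.update_of_ne h₁₃]; simp
  · exact absurd rfl hne
  · simp

omit [DecidableEq V] [LinearOrder R] [IsStrictOrderedRing R] in
/-- Flip `e₁` at the isolated `z`: `(1,0,0) → (0,0,0)`. -/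
lemma prob_flip₁ (p : E → R) {e₁ e₂ e₃ : E} {a₁ z : V} (h₁ : ends e₁ = s(a₁, z))
    (hz : ∀ e, z ∈ ends e → e = e₁ ∨ e = e₂ ∨ e = e₃) (h₁₂ : e₁ ≠ e₂) (h₁₃ : e₁ ≠ e₃)
    (h₂₃ : e₂ ≠ e₃) {X : Set (Config E)} (hX : ∀ (e : E) (t : V), ends e = s(t, z) → ∀ ω : Config E,
      (∀ e', z ∈ ends e' → ω e' = false) → (Function.update ω e true ∈ X ↔ ω ∈ X)) :
    prob (Function.update (Function.update (Function.update p e₁ 1) e₂ 0) e₃ 0) X =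
      prob (Function.update (Function.update (Function.update p e₁ 0) e₂ 0) e₃ 0) X := by
  rw [update_comm' p h₁₂ 1 0, update_comm' (Function.update p e₂ 0) h₁₃ 1 0,
    update_comm' p h₁₂ 0 0, update_comm' (Function.update p e₂ 0) h₁₃ 0 0]
  refine prob_update_one_eq_update_zero_of_isolated (ends := ends) _ (z := z) ?_ (hX e₁ a₁ h₁)
  intro e' hz' hne
  rcases hz e' hz' with rfl | rfl | rfl
  · exact absurd rfl hne
  · rw [Function.update_of_ne h₂₃]; simp
  · simp

omit [Fintype E] [DecidableEq E] [LinearOrder R] [IsStrictOrderedRing R] in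
/-- On the support of a measure with `e₁ = {a₁, z}`, `e₂ = {z, v}` sure, `Q ∩ {a₁ ↔ v} ∩ A` and
`Q ∩ A` are `{a₂ ↮ a₁, z, v} ∩ A`. -/
lemma inter_supp_sure_path_eq (q : E → R) {e₁ e₂ : E} {a₁ a₂ z v : V} (h₁ : ends e₁ = s(a₁, z))
    (h₂ : ends e₂ = s(z, v)) (hq₁ : q e₁ = 1) (hq₂ : q e₂ = 1) (A : Set (Config E)) :
    avoidAll ends a₂ {a₁} ∩ (connEvent ends a₁ v ∩ A) ∩ supp q =
        avoidAll ends a₂ (insert a₁ (insert z {v})) ∩ A ∩ supp q ∧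
      avoidAll ends a₂ {a₁} ∩ A ∩ supp q =
        avoidAll ends a₂ (insert a₁ (insert z {v})) ∩ A ∩ supp q := by
  have hL : ∀ ω ∈ supp q, Conn ends ω a₁ z ∧ Conn ends ω z v := fun ω hs =>
    ⟨conn_of_openAdj ⟨e₁, (hs e₁).1 hq₁, h₁⟩, conn_of_openAdj ⟨e₂, (hs e₂).1 hq₂, h₂⟩⟩
  have key : ∀ ω ∈ supp q, ω ∈ avoidAll ends a₂ {a₁} →
      ω ∈ avoidAll ends a₂ (insert a₁ (insert z {v})) := by
    intro ω hs hQ x hx hc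
    obtain ⟨hz, hzv⟩ := hL ω hs
    rcases Finset.mem_insert.1 hx with rfl | hx
    · exact hQ x (Finset.mem_singleton_self x) hc
    · rcases Finset.mem_insert.1 hx with rfl | hx
      · exact hQ a₁ (Finset.mem_singleton_self a₁) (conn_trans hc (conn_symm hz))
      · rw [Finset.mem_singleton] at hx
        subst hx
        exact hQ a₁ (Finset.mem_singleton_self a₁)
          (conn_trans hc (conn_symm (conn_trans hz hzv)))
  have back : ∀ ω, ω ∈ avoidAll ends a₂ (insert a₁ (insert z {v})) →
      ω ∈ avoidAll ends a₂ {a₁} :=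
    fun ω h x hx => h x (by rw [Finset.mem_singleton] at hx; rw [hx]; exact Finset.mem_insert_self _ _)
  constructor
  · ext ω
    simp only [Set.mem_inter_iff]
    constructor
    · rintro ⟨⟨hQ, -, hA⟩, hs⟩
      exact ⟨⟨key ω hs hQ, hA⟩, hs⟩
    · rintro ⟨⟨hQ', hA⟩, hs⟩
      obtain ⟨hz, hzv⟩ := hL ω hs
      exact ⟨⟨back ω hQ', conn_trans hz hzv, hA⟩, hs⟩
  · ext ω
    simp only [Set.mem_inter_iff]
    constructor
    · rintro ⟨⟨hQ, hA⟩, hs⟩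
      exact ⟨⟨key ω hs hQ, hA⟩, hs⟩
    · rintro ⟨⟨hQ', hA⟩, hs⟩
      exact ⟨⟨back ω hQ', hA⟩, hs⟩

omit [Fintype E] [DecidableEq E] [LinearOrder R] [IsStrictOrderedRing R] in
/-- On the support of a measure where all edges at `z` are null, `z ∉ K`, so the avoidance of
`{a₁, z, v}` is the avoidance of `{a₁, v}`. -/
lemma inter_supp_isolated_eq (q : E → R) {z a₁ a₂ v : V} (hza₂ : a₂ ≠ z)
    (hz : ∀ e, z ∈ ends e → q e = 0) (A : Set (Config E)) :
    avoidAll ends a₂ (insert a₁ (insert z {v})) ∩ A ∩ supp q =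
      avoidAll ends a₂ (insert a₁ {v}) ∩ A ∩ supp q := by
  ext ω
  simp only [Set.mem_inter_iff]
  constructor
  · rintro ⟨⟨h, hA⟩, hs⟩
    refine ⟨⟨fun x hx => h x ?_, hA⟩, hs⟩
    rcases Finset.mem_insert.1 hx with rfl | hx
    · exact Finset.mem_insert_self _ _
    · exact Finset.mem_insert_of_mem (Finset.mem_insert_of_mem hx)
  · rintro ⟨⟨h, hA⟩, hs⟩
    refine ⟨⟨fun x hx hc => ?_, hA⟩, hs⟩
    have hiso : ∀ e, z ∈ ends e → ω e = false := fun e he => (hs e).2 (hz e he)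
    rcases Finset.mem_insert.1 hx with rfl | hx
    · exact h x (Finset.mem_insert_self _ _) hc
    · rcases Finset.mem_insert.1 hx with rfl | hx
      · exact hza₂ (eq_of_conn_of_isolated hiso (conn_symm hc))
      · exact h x (Finset.mem_insert_of_mem hx) hc

omit [LinearOrder R] [IsStrictOrderedRing R] in
/-- **The `(1,1,0)` law is the `v ∉ K` law of the core**: for `A` a cluster event of `o`, `b`
(given as `A = univ`, a membership or a double membership through `𝓤`),
`P¹¹⁰(Q ∩ {a₁ ↔ v} ∩ A) = P⁰⁰⁰({a₂ ↮ a₁, v} ∩ A)` and `P¹¹⁰(Q ∩ A) = P⁰⁰⁰({a₂ ↮ a₁, v} ∩ A)`. -/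
lemma prob_sure_path_eq (p : E → R) {e₁ e₂ e₃ : E} {a₁ a₂ z v : V} (h₁ : ends e₁ = s(a₁, z))
    (h₂ : ends e₂ = s(z, v)) (hza₂ : a₂ ≠ z)
    (hz : ∀ e, z ∈ ends e → e = e₁ ∨ e = e₂ ∨ e = e₃) (h₁₂ : e₁ ≠ e₂) (h₁₃ : e₁ ≠ e₃)
    (h₂₃ : e₂ ≠ e₃) (𝓤 : Set (Set V)) :
    prob (Function.update (Function.update (Function.update p e₁ 1) e₂ 1) e₃ 0)
        (avoidAll ends a₂ {a₁} ∩ (connEvent ends a₁ v ∩ clusterInEvent ends a₂ 𝓤)) =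
      prob (Function.update (Function.update (Function.update p e₁ 0) e₂ 0) e₃ 0)
        (avoidAll ends a₂ (insert a₁ {v}) ∩ clusterInEvent ends a₂ 𝓤) ∧
    prob (Function.update (Function.update (Function.update p e₁ 1) e₂ 1) e₃ 0)
        (avoidAll ends a₂ {a₁} ∩ clusterInEvent ends a₂ 𝓤) =
      prob (Function.update (Function.update (Function.update p e₁ 0) e₂ 0) e₃ 0)
        (avoidAll ends a₂ (insert a₁ {v}) ∩ clusterInEvent ends a₂ 𝓤) := by
  set q₁₁₀ := Function.update (Function.update (Function.update p e₁ 1) e₂ 1) e₃ 0 with hq₁₁₀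
  set q₀₀₀ := Function.update (Function.update (Function.update p e₁ 0) e₂ 0) e₃ 0 with hq₀₀₀
  have hq₁ : q₁₁₀ e₁ = 1 := by
    rw [hq₁₁₀, Function.update_of_ne h₁₃, Function.update_of_ne h₁₂]; simp
  have hq₂ : q₁₁₀ e₂ = 1 := by
    rw [hq₁₁₀, Function.update_of_ne h₂₃]; simp
  -- the events are determined off `e₁, e₂`
  have hπ : ∀ e' ∈ ({e₁, e₂} : Finset E), ∀ x, x ∈ ends e' →
      x = a₁ ∨ x ∈ (insert z {v} : Finset V) := by
    intro e' he' x hx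
    rcases Finset.mem_insert.1 he' with rfl | he'
    · rw [h₁, Sym2.mem_iff] at hx
      rcases hx with rfl | rfl
      · exact Or.inl rfl
      · exact Or.inr (Finset.mem_insert_self _ _)
    · rw [Finset.mem_singleton] at he'
      subst he'
      rw [h₂, Sym2.mem_iff] at hx
      rcases hx with rfl | rfl
      · exact Or.inr (Finset.mem_insert_self _ _)
      · exact Or.inr (Finset.mem_insert_of_mem (Finset.mem_singleton_self _))
  have hdep := dependsOn_avoid_clusterIn (ends := ends) hπ a₂ 𝓤
  have hdep₁ : DependsOn (· ∈ avoidAll ends a₂ (insert a₁ (insert z {v})) ∩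
      clusterInEvent ends a₂ 𝓤) (({e₁} : Finset E) : Set E)ᶜ := by
    refine hdep.mono ?_
    intro e he
    simp only [Set.mem_compl_iff, Finset.coe_insert, Finset.coe_singleton, Set.mem_insert_iff,
      Set.mem_singleton_iff, not_or] at he ⊢
    exact fun h => he.1 h
  have hdep₂ : DependsOn (· ∈ avoidAll ends a₂ (insert a₁ (insert z {v})) ∩
      clusterInEvent ends a₂ 𝓤) (({e₂} : Finset E) : Set E)ᶜ := by
    refine hdep.mono ?_
    intro e he
    simp only [Set.mem_compl_iff, Finset.coe_insert, Finset.coe_singleton, Set.mem_insert_iff,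
      Set.mem_singleton_iff, not_or] at he ⊢
    exact fun h => he.2 h
  -- the two flips
  have hflip : prob q₁₁₀ (avoidAll ends a₂ (insert a₁ (insert z {v})) ∩ clusterInEvent ends a₂ 𝓤) =
      prob q₀₀₀ (avoidAll ends a₂ (insert a₁ (insert z {v})) ∩ clusterInEvent ends a₂ 𝓤) := by
    rw [hq₁₁₀, hq₀₀₀, update_comm' (Function.update p e₁ 1) h₂₃ 1 0,
      prob_update_one_eq_update_zero_of_dependsOn _ e₂ hdep₂,
      ← update_comm' (Function.update p e₁ 1) h₂₃ 0 0, update_comm' p h₁₂ 1 0,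
      update_comm' (Function.update p e₂ 0) h₁₃ 1 0,
      prob_update_one_eq_update_zero_of_dependsOn _ e₁ hdep₁,
      ← update_comm' (Function.update p e₂ 0) h₁₃ 0 0, ← update_comm' p h₁₂ 0 0]
  -- on the support of `q₀₀₀`, `z ∉ K`
  have hz0 : ∀ e, z ∈ ends e → q₀₀₀ e = 0 := by
    intro e he
    rcases hz e he with rfl | rfl | rfl
    · rw [hq₀₀₀, Function.update_of_ne h₁₃, Function.update_of_ne h₁₂]; simp
    · rw [hq₀₀₀, Function.update_of_ne h₂₃]; simp
    · rw [hq₀₀₀]; simp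
  have hiso := inter_supp_isolated_eq (ends := ends) q₀₀₀ (a₁ := a₁) (v := v) hza₂ hz0
    (clusterInEvent ends a₂ 𝓤)
  obtain ⟨hs1, hs2⟩ := inter_supp_sure_path_eq (ends := ends) q₁₁₀ h₁ h₂ hq₁ hq₂
    (clusterInEvent ends a₂ 𝓤)
  refine ⟨?_, ?_⟩
  · rw [prob_congr_supp _ hs1, hflip, prob_congr_supp _ hiso]
  · rw [prob_congr_supp _ hs2, hflip, prob_congr_supp _ hiso]

end Identify

section Main

variable {V : Type*} {E : Type*} [Fintype E] [DecidableEq E] [Fintype V] [DecidableEq V]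
  {R : Type*} [Field R] [LinearOrder R] [IsStrictOrderedRing R]
variable {ends : E → Sym2 V}

omit [Fintype V] [DecidableEq V] [LinearOrder R] [IsStrictOrderedRing R] in
/-- With `e₁ = {a₁, z}`, `e₂ = {z, v}` sure, `a₁ ↔ v` surely. -/
lemma prob_conn_eq_one_of_sure_path (q : E → R) {e₁ e₂ : E} {a₁ z v : V}
    (h₁ : ends e₁ = s(a₁, z)) (h₂ : ends e₂ = s(z, v)) (hq₁ : q e₁ = 1) (hq₂ : q e₂ = 1) :
    prob q (connEvent ends a₁ v) = 1 := by
  have hcongr : prob q (connEvent ends a₁ v) = prob q Set.univ := by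
    apply prob_congr_supp
    ext ω
    simp only [Set.mem_inter_iff, Set.mem_univ, true_and, and_iff_right_iff_imp]
    intro hs
    exact conn_trans (conn_of_openAdj ⟨e₁, (hs e₁).1 hq₁, h₁⟩)
      (conn_of_openAdj ⟨e₂, (hs e₂).1 hq₂, h₂⟩)
  rw [hcongr, prob_univ]

omit [Fintype V] [DecidableEq V] in
/-- The constant `C = π̃₁₂ + aζ(1 − π̃₁₂)` is admissible: `C ≤ P(a₁ ↔ v)`. -/
lemma const_le_pi_blob (p : E → R) (hp : IsProbVec p) {π₁ π₂ : Finset E} {V₁ V₂ : Finset V}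
    {a₁ v z : V} {e₁ e₂ e₃ : E} (h₁ : ends e₁ = s(a₁, z)) (h₂ : ends e₂ = s(z, v))
    (h₁₂ : e₁ ≠ e₂) (h₁₃ : e₁ ≠ e₃) (h₂₃ : e₂ ≠ e₃) (hd : Disjoint π₁ π₂)
    (he₁₁ : e₁ ∉ π₁) (he₁₂ : e₁ ∉ π₂) (he₂₁ : e₂ ∉ π₁) (he₂₂ : e₂ ∉ π₂) (he₃₁ : e₃ ∉ π₁)
    (he₃₂ : e₃ ∉ π₂)
    (hconn₁ : ∀ ω ∈ allOpen π₁, ∀ x ∈ V₁, Conn ends ω a₁ x)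
    (hconn₂ : ∀ ω ∈ allOpen π₂, ∀ x ∈ V₂, Conn ends ω a₁ x)
    (hv₁ : v ∈ V₁) (hv₂ : v ∈ V₂) :
    (∏ e ∈ π₁, p e + ∏ e ∈ π₂, p e - (∏ e ∈ π₁, p e) * ∏ e ∈ π₂, p e) +
        p e₁ * p e₂ *
          (1 - (∏ e ∈ π₁, p e + ∏ e ∈ π₂, p e - (∏ e ∈ π₁, p e) * ∏ e ∈ π₂, p e)) ≤
      prob p (connEvent ends a₁ v) := by
  have hlow : ∀ ε₁ ε₂ ε₃ : R, 0 ≤ ε₁ → ε₁ ≤ 1 → 0 ≤ ε₂ → ε₂ ≤ 1 → 0 ≤ ε₃ → ε₃ ≤ 1 →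
      ∏ e ∈ π₁, p e + ∏ e ∈ π₂, p e - (∏ e ∈ π₁, p e) * ∏ e ∈ π₂, p e ≤
        prob (Function.update (Function.update (Function.update p e₁ ε₁) e₂ ε₂) e₃ ε₃)
          (connEvent ends a₁ v) := by
    intro ε₁ ε₂ ε₃ h0 h1 h2 h3 h4 h5
    have hq : IsProbVec (Function.update (Function.update (Function.update p e₁ ε₁) e₂ ε₂) e₃ ε₃) :=
      ((hp.update e₁ h0 h1).update e₂ h2 h3).update e₃ h4 h5
    rw [← prod_update_three p ε₁ ε₂ ε₃ he₁₁ he₂₁ he₃₁,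
      ← prod_update_three p ε₁ ε₂ ε₃ he₁₂ he₂₂ he₃₂, ← prob_allOpen_union _ hd]
    refine prob_mono hq fun ω hω => ?_
    rcases hω with h | h
    · exact hconn₁ ω h v hv₁
    · exact hconn₂ ω h v hv₂
  have hone : ∀ ε₃ : R,
      prob (Function.update (Function.update (Function.update p e₁ 1) e₂ 1) e₃ ε₃)
        (connEvent ends a₁ v) = 1 := by
    intro ε₃
    refine prob_conn_eq_one_of_sure_path _ h₁ h₂ ?_ ?_
    · rw [Function.update_of_ne h₁₃, Function.update_of_ne h₁₂]; simp
    · rw [Function.update_of_ne h₂₃]; simp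
  rw [prob_pin_three p _ h₁₂ h₁₃ h₂₃, hone 1, hone 0]
  have ha0 := hp.nonneg e₁
  have ha1 := hp.le_one e₁
  have hζ0 := hp.nonneg e₂
  have hζ1 := hp.le_one e₂
  have hr0 := hp.nonneg e₃
  have hr1 := hp.le_one e₃
  have w₁ : 0 ≤ p e₁ * (1 - p e₂) * p e₃ := mul_nonneg (mul_nonneg ha0 (by linarith)) hr0
  have w₂ : 0 ≤ p e₁ * (1 - p e₂) * (1 - p e₃) :=
    mul_nonneg (mul_nonneg ha0 (by linarith)) (by linarith)
  have w₃ : 0 ≤ (1 - p e₁) * p e₂ * p e₃ := mul_nonneg (mul_nonneg (by linarith) hζ0) hr0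
  have w₄ : 0 ≤ (1 - p e₁) * p e₂ * (1 - p e₃) :=
    mul_nonneg (mul_nonneg (by linarith) hζ0) (by linarith)
  have w₅ : 0 ≤ (1 - p e₁) * (1 - p e₂) * p e₃ :=
    mul_nonneg (mul_nonneg (by linarith) (by linarith)) hr0
  have w₆ : 0 ≤ (1 - p e₁) * (1 - p e₂) * (1 - p e₃) :=
    mul_nonneg (mul_nonneg (by linarith) (by linarith)) (by linarith)
  have k₁ := mul_le_mul_of_nonneg_left (hlow 1 0 1 zero_le_one le_rfl le_rfl zero_le_one
    zero_le_one le_rfl) w₁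
  have k₂ := mul_le_mul_of_nonneg_left (hlow 1 0 0 zero_le_one le_rfl le_rfl zero_le_one
    le_rfl zero_le_one) w₂
  have k₃ := mul_le_mul_of_nonneg_left (hlow 0 1 1 le_rfl zero_le_one zero_le_one le_rfl
    zero_le_one le_rfl) w₃
  have k₄ := mul_le_mul_of_nonneg_left (hlow 0 1 0 le_rfl zero_le_one zero_le_one le_rfl
    le_rfl zero_le_one) w₄
  have k₅ := mul_le_mul_of_nonneg_left (hlow 0 0 1 le_rfl zero_le_one le_rfl zero_le_one
    zero_le_one le_rfl) w₅
  have k₆ := mul_le_mul_of_nonneg_left (hlow 0 0 0 le_rfl zero_le_one le_rfl zero_le_one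
    le_rfl zero_le_one) w₆
  have key : (∏ e ∈ π₁, p e + ∏ e ∈ π₂, p e - (∏ e ∈ π₁, p e) * ∏ e ∈ π₂, p e) +
      p e₁ * p e₂ * (1 - (∏ e ∈ π₁, p e + ∏ e ∈ π₂, p e - (∏ e ∈ π₁, p e) * ∏ e ∈ π₂, p e)) =
      p e₁ * p e₂ * p e₃ * 1 + p e₁ * p e₂ * (1 - p e₃) * 1 +
        (p e₁ * (1 - p e₂) * p e₃ + p e₁ * (1 - p e₂) * (1 - p e₃) + (1 - p e₁) * p e₂ * p e₃ +
          (1 - p e₁) * p e₂ * (1 - p e₃) + (1 - p e₁) * (1 - p e₂) * p e₃ +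
          (1 - p e₁) * (1 - p e₂) * (1 - p e₃)) *
        (∏ e ∈ π₁, p e + ∏ e ∈ π₂, p e - (∏ e ∈ π₁, p e) * ∏ e ∈ π₂, p e) := by ring
  rw [key]
  linarith [k₁, k₂, k₃, k₄, k₅, k₆]

end Main

end CrossAPrimeThreeRoutesBlobMasses

end Summit.Ventures.PercRepro2
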